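import Literature.NumberTheory.Automorphic.BCDTModularity
import Literature.NumberTheory.EllipticCurves.NewformsTwistNewProofs
import Literature.NumberTheory.EllipticCurves.QuadraticTwistNegOneLFunctionProofs
import HarnessLib

/-!
# Modularity of elliptic curves over `ℚ` is invariant under coprime quadratic twists — proofs

A `…Proofs` companion (theorems only: no definition, no named fact, no instance; D-0026) of
`Literature.NumberTheory.Automorphic.BCDTModularity`, whose `BCDT.IsModular W` is
Breuil–Conrad–Diamond–Taylor's condition (2): a newform `f ∈ S₂(Γ₀(N_W))` **at the conductor level**
with `aₙ(f) = aₙ(W)` for all `n` (`IsNewformOf`).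

Silverberg (in Cornell–Silverman–Stevens 1997, Ch. XVIII, p. 539): "if `E ≅_ℂ E′` then `E` is modular
iff `E′` is modular" — over `ℚ` this is invariance of modularity under quadratic twists `E ↦ E^{(d)}`.
On the modular-forms side it is the theorem of Atkin–Li 1978, §3: the twist `f ⊗ χ_d` of the
newform `f` of `E` is equivalent to a newform of level `N_{E^{(d)}}`, which is the newform of
`E^{(d)}`.  This file PROVES the coprime prime-power-conductor case from the tree's
`isNewform0_charTwist_of_isPrimePow_of_coprime` (`NewformsTwistNewProofs`, the exact level
`N m²` of `f ⊗ ψ` for `(m, N) = 1`, `m = q^c`):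

* `isModular_of_isNewformOf_of_eq` — a newform of `W` at a level EQUAL to the conductor makes `W`
  modular (transport along the propositional equality of levels);
* `IsModular.of_LFunction_eq_twist` — **if `W` is modular, `ψ` is a primitive quadratic character mod
  `m = q^c` with `(N_W, m) = 1`, and `W'` is a Weierstrass curve with `aₙ(W') = ψ(n) aₙ(W)` for all
  `n` and `N_{W'} = N_W m²`, then `W'` is modular**: the newform of `W'` is `f_W ⊗ ψ`;
* `IsModular.quadraticTwist_neg_one` — the case `ψ = χ₋₄` (`m = 4`), `W' = W^{(−1)}`: for `W`
  modular of ODD conductor with `W^{(−1)}` additive at `2` and `N_{W^{(−1)}} = 16 N_W`, the twist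
  `W^{(−1)}` is modular (`aₙ(W^{(−1)}) = χ₄(n) aₙ(W)`, `LFunction_quadraticTwist_neg_one_apply_complex`).

The conductor hypothesis `N_{W'} = N_W m²` is the curve-side input (Tate's algorithm for the twisted
model: `f_p(W') = f_p(W)` for `p ∤ m`, `f_q(W') = 2 v_q(m)`); it is NOT derivable from the newform
side inside the tree (that would be Carayol's theorem `IsNewformOf.level_eq_conductorNorm` for `W'`),
and is discharged by the tree case by case (e.g. `WeierstrassCurve.conductorNorm_eq_mul_sq_of_twist`,
`RootNumberTwistProofs`).  For the Frey–Hellegouarch curves `E_(A,B)` of odd conductor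
(`A ≡ −1 (4)`, `2⁴ ∥ B`) the un-normalised presentations `E_(B,A) = E_(A,B)^{(−1)}`
(`quadraticTwist_freyCurve_neg_one`) thus inherit modularity, granted `N(E_(B,A)) = 16 N(E_(A,B))`.

## References

* [AtkinLi1978] A. O. L. Atkin, W.-C. W. Li, *Twists of newforms and pseudo-eigenvalues of
  `W`-operators*, Invent. Math. 48 (1978), §3, Thm. 3.1.
* [BCDTJAMS2001] C. Breuil, B. Conrad, F. Diamond, R. Taylor, J. Amer. Math. Soc. 14 (2001),
  Introduction, condition (2).
* [cornell1997] G. Cornell, J. H. Silverman, G. Stevens (eds.), *Modular forms and Fermat's Last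
  Theorem* (1997), Ch. XVIII (Silverberg), p. 539; Ch. XVII (Diamond).
-/

noncomputable section

open scoped MatrixGroups ModularForm

open CongruenceSubgroup

namespace Literature.NumberTheory.Automorphic.BCDT

open EllipticCurves.ModularForms WeierstrassCurve

/-- **A newform of `W` at a level equal to the conductor makes `W` modular** (BCDT condition (2);
transport of `IsNewformOf W F`, `F ∈ S₂(Γ₀(L))`, along `L = N_W`). [cite: BCDTJAMS2001, Introduction, condition (2)] -/
theorem isModular_of_isNewformOf_of_eq (W : WeierstrassCurve ℚ) [NeZero (W.conductorNorm ℤ)]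
    {L : ℕ} [NeZero L] {F : CuspForm (Gamma0 L) 2} (hF : IsNewformOf W F)
    (hL : L = W.conductorNorm ℤ) : IsModular W := by
  subst hL
  exact ⟨F, hF⟩

/-- **Twist invariance of modularity (coprime prime-power conductor).**  Let `W / ℚ` be modular
(`IsModular W`: newform `f` at level `N_W` with `aₙ(f) = aₙ(W)`), `ψ` a primitive quadratic Dirichlet
character mod `m`, `m = q^c` a prime power with `(N_W, m) = 1`, and `W' / ℚ` a Weierstrass curve with
`aₙ(W') = ψ(n) aₙ(W)` for all `n` and `N_{W'} = N_W m²`.  Then `W'` is modular: its newform is the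
twist `f_ψ ∈ S₂(Γ₀(N_W m²))`, a newform by Atkin–Li (`isNewform0_charTwist_of_isPrimePow_of_coprime`)
with `aₙ(f_ψ) = ψ(n) aₙ(f) = aₙ(W')` (`cuspCoeff_charTwist`).  (Atkin–Li 1978, §3; Silverberg in
Cornell–Silverman–Stevens 1997, p. 539: modularity is an isomorphism-over-`ℂ` invariant.)
[cite: AtkinLi1978, §3, Thm. 3.1] -/
theorem IsModular.of_LFunction_eq_twist {W : WeierstrassCurve ℚ} [NeZero (W.conductorNorm ℤ)]
    (hW : IsModular W) {m : ℕ} [NeZero m] {ψ : DirichletCharacter ℂ m} (hψ : ψ.IsQuadratic)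
    (hprim : ψ.IsPrimitive) (hm : IsPrimePow m) (hNm : (W.conductorNorm ℤ).Coprime m)
    (W' : WeierstrassCurve ℚ) [NeZero (W'.conductorNorm ℤ)]
    (hcoeff : ∀ n : ℕ, (W'.LFunction n : ℂ) = ψ n * (W.LFunction n : ℂ))
    (hN' : W'.conductorNorm ℤ = W.conductorNorm ℤ * m ^ 2) : IsModular W' := by
  obtain ⟨f, hf⟩ := hW
  haveI : NeZero (W.conductorNorm ℤ * m ^ 2) :=
    ⟨mul_ne_zero (NeZero.ne (W.conductorNorm ℤ)) (pow_ne_zero 2 (NeZero.ne m))⟩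
  have hF : IsNewform0 (charTwist (W.conductorNorm ℤ * m ^ 2) (dvd_mul_right (W.conductorNorm ℤ) (m ^ 2))
      (dvd_mul_left (m ^ 2) (W.conductorNorm ℤ)) hψ f) :=
    isNewform0_charTwist_of_isPrimePow_of_coprime hψ hprim hm hNm hf.1
  have hFW' : IsNewformOf W' (charTwist (W.conductorNorm ℤ * m ^ 2)
      (dvd_mul_right (W.conductorNorm ℤ) (m ^ 2)) (dvd_mul_left (m ^ 2) (W.conductorNorm ℤ)) hψ f) :=
    ⟨hF, fun n ↦ by rw [cuspCoeff_charTwist _ _ _ hψ hprim f n, hf.2 n, hcoeff n]⟩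
  exact isModular_of_isNewformOf_of_eq W' hFW' hN'.symm

/-- `4 = 2²` is a prime power. [folklore] -/
theorem isPrimePow_four : IsPrimePow (4 : ℕ) :=
  (isPrimePow_nat_iff 4).mpr ⟨2, 2, Nat.prime_two, two_pos, by norm_num⟩

/-- **The twist by `−1` of a modular curve of odd conductor is modular** (granted its conductor):
for `W / ℚ` elliptic and modular with `N_W` odd, whose twist `W^{(−1)} = W.quadraticTwist (−1)` has
additive reduction at the place over `2` and conductor `N_{W^{(−1)}} = 16 N_W`, the curve `W^{(−1)}` is
modular — `IsModular.of_LFunction_eq_twist` with `ψ = χ₋₄ = χ₄ ⊗ ℂ` (primitive quadratic mod `4 = 2²`)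
and `aₙ(W^{(−1)}) = χ₄(n) aₙ(W)` (`LFunction_quadraticTwist_neg_one_apply_complex`; Silverman, *AEC*
X.5 Cor. 5.4 / Exercise 10.16).  The newform of `W^{(−1)}` is `f_W ⊗ χ₋₄ ∈ S₂(Γ₀(16 N_W))`
(Atkin–Lehner 1970, §6; Atkin–Li 1978, §3). [cite: AtkinLi1978, §3, Thm. 3.1] -/
theorem IsModular.quadraticTwist_neg_one {W : WeierstrassCurve ℚ} [W.IsElliptic]
    [NeZero (W.conductorNorm ℤ)] (hW : IsModular W) (hodd : ¬ 2 ∣ W.conductorNorm ℤ)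
    (hadd : ∀ v : IsDedekindDomain.HeightOneSpectrum (NumberField.RingOfIntegers ℚ),
      (Rat.HeightOneSpectrum.primesEquiv v : ℕ) = 2 → (W.quadraticTwist (-1)).HasAdditiveReductionAt v)
    [NeZero ((W.quadraticTwist (-1)).conductorNorm ℤ)]
    (hN' : (W.quadraticTwist (-1)).conductorNorm ℤ = 16 * W.conductorNorm ℤ) :
    IsModular (W.quadraticTwist (-1)) := by
  haveI : NeZero (4 : ℕ) := ⟨by norm_num⟩
  have hNm : (W.conductorNorm ℤ).Coprime 4 := by
    have h2 : (W.conductorNorm ℤ).Coprime 2 := (Nat.prime_two.coprime_iff_not_dvd.mpr hodd).symm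
    simpa using h2.pow_right 2
  exact IsModular.of_LFunction_eq_twist hW isQuadratic_χ₄_ringHomComp isPrimitive_χ₄_ringHomComp
    isPrimePow_four hNm (W.quadraticTwist (-1)) (W.LFunction_quadraticTwist_neg_one_apply_complex hadd)
    (by rw [hN']; ring)

end Literature.NumberTheory.Automorphic.BCDT

end
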